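import Mathlib
import HarnessLib
import Summits.ResolutionOfSingularities.ResolutionOfSingularities.Theorems.WildQuotientsWildQuotientResolutionS1aNodeChartAway
import Summits.ResolutionOfSingularities.ResolutionOfSingularities.Theorems.WildQuotientsWildQuotientResolutionS1aTerminalLocus
import Summits.ResolutionOfSingularities.ResolutionOfSingularities.Theorems.WildQuotientsWildQuotientResolutionS1aGoodOfKilledNode
import Summits.ResolutionOfSingularities.ResolutionOfSingularities.Theorems.WildQuotientsWildQuotientResolutionS1aNodeChartFiniteType
import Summits.ResolutionOfSingularities.ResolutionOfSingularities.Theorems.WildQuotientsWildQuotientResolutionS1aKillMeasure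

/-!
# S1a — np-FRAME foundations (np-ATLAS reading): node atlas DATA, the «principal near u» predicate, the non-principal locus

[OURS · L1 W4.5c · lead-1 g11; plan-1 RULINGS R-F10 (np-FRAME) / R-F11 (np-ATLAS), 2026-08-28: «(α) `GModel` gains atlas DATA `𝔄` = a family of stable affine
opens covering V with node data (Bᵢ, 𝒜ᵢ, σᵢ, eᵢ) exactly as in `IsNodeChart`, plus `compat`; (β) `npLocus M := {u | ∃ (⟺ ∀, by compat) chart of 𝔄 at u
non-principal at u}`»; this file = lead-1's SIG NP v2 CANDIDATE for (α)/(β), checked Lean] — NOT statements of the manuscript; counted 0; AI-level work, weaker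
than expert review. Crux stmt-ResolutionOfSingularities-17941 `CyclicQuotientFourfolds`, line `s1a-logminvertex` (v11 → v12). Route-independent.

WHY (F10): `M.badLocus` (no stable affine open with tame-root-regular invariants) is not «augmentation ideal non-principal on a node chart»: multiplicative fixed
points are typed-good with non-principal augmentation (plan-1 A-NIL v0), and «formally bad ⇒ typed bad» contains Király–Lütkebohmert's Conjecture 10. The game's
MEASURE is therefore re-based on the NON-PRINCIPAL LOCUS of a chosen node ATLAS (data), on which K-TIGHT is algebra (`…S1aKillTightRing`, `…S1aKillExo`).

DESIGN CHOICES (lead-1's call, R-F11 (γ)): the atlas is DATA carried next to a `GModel` (new structure `NpModel` in the sequel file; `GModel` is untouched —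
append-only tree, 100+ importers); «principal at u» is the OPEN condition `PrincipalNear` = «some G-INVARIANT section b with b(u) ≠ 0 makes the augmentation
ideal of the node ring principal after inverting e(b)» (invariant b ⇒ the shrunk chart `basicOpenStable` is again a node chart, `exists_nodeData_basicOpen`,
and the predicate is G-stable for free); no new move kind (Laurent refinements are folded into the atlas data of the initial model / of each move).

* `NodeData p ρ g₀ O` (structure, Type-valued twin of `IsNodeChart`; the ring instances are FIELDS, used via `letI := D.instCommRing` — no global instance attribute), `NodeData.isNodeChart`;
* `NodeData.PrincipalNear D u`; `principalNear_of_mem_basicOpen` (openness), `principalNear_aut_iff` (G-stability);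
* `NodeAtlasData p ρ g₀` (charts + data + cover), `NodeAtlasData.nodeAtlas`, `NodeAtlasData.Compatible`;
* `NodeAtlasData.npLocus` (∃-form), `mem_npLocus_iff_forall` (under `Compatible`), ★ `isClosed_npLocus`, ★ `preimage_aut_npLocus` (G-stable);
* `NodeAtlasData.fLocus` — the CARRIED FORMAL LOCUS `F_𝔄` (∀-form, R-F14: «no chart of the atlas is principal near u»; NO compatibility needed):
  `isClosed_fLocus`, `preimage_aut_fLocus`, `badLocus_subset_fLocus`, `terminal_of_fLocus_eq_empty`; `NodeData.ofIsNodeChart`, `NodeAtlasData.ofNodeAtlas` (choice).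
* ★ `GameFrame.GModel.isGoodAt_of_principalNear` — the BRIDGE «principal near `u` ⇒ good at `u`» (killed node on the invariant basic open:
  `exists_nodeData_basicOpen` + `augmentationIdeal_sigmaAway` + `exists_baseRingHom_of_nodeChart` + `isGoodAt_of_killedNode`), hence for a model carrying
  compatible atlas data `badLocus ⊆ npLocus` (`badLocus_subset_npLocus`) and `npLocus = ∅ ⇒ Terminal` (`terminal_of_npLocus_eq_empty`).
`NpModel` (GModel + atlas data) and the np-measure follow in `…S1aNpModel`.
-/

set_option linter.dupNamespace false

noncomputable section

universe u

open CategoryTheory Limits AlgebraicGeometry TopologicalSpace Topology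
open Literature.AlgebraicGeometry.Resolution Literature.AlgebraicGeometry.RelativeSpec
open Summit.ResolutionOfSingularities.ResolutionOfSingularities.Theorems.WildQuotientResolution.S1
open Summit.ResolutionOfSingularities.ResolutionOfSingularities.Theorems.WildQuotientResolution.S1.NodeAtlas
open Summit.ResolutionOfSingularities.ResolutionOfSingularities.Theorems.WildQuotientResolution.S1.ProducerStep
open Summit.ResolutionOfSingularities.ResolutionOfSingularities.Theorems.WildQuotientResolution.S1.GoodCharts

namespace Summit.ResolutionOfSingularities.ResolutionOfSingularities.Theorems.WildQuotientResolution.S1.NpFrame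

variable (p : ℕ) {V Y : Scheme.{u}} {q : V ⟶ Y} {G : Type u} [Group G] (ρ : ActionOver q G) (g₀ : G)

/-! ## Node DATA on a stable affine open -/

/-- **Node data** on a `G`-stable open affine over the base: the Type-valued twin of `IsNodeChart` — a tame node `(B, 𝒜, σ)` graded by
`Π j : Fin m, ZMod (r j)` and a ring isomorphism `e : Γ(V, O) ≃ 𝒜 0` intertwining the action of `g₀` with `σ`. [OURS · L1 W4.5c · np-ATLAS (α)] -/
structure NodeData (O : ρ.StableAffineOpens) : Type (u + 1) where
  /-- the chart is affine -/
  affine : IsAffineOpen O.1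
  /-- rank of the grading group -/
  m : ℕ
  /-- moduli of the grading group `Π j, ZMod (r j)` -/
  r : Fin m → ℕ
  /-- the node ring -/
  B : Type u
  [instCommRing : CommRing B]
  /-- the grading -/
  𝒜 : (Π j : Fin m, ZMod (r j)) → AddSubgroup B
  [instGradedRing : GradedRing 𝒜]
  /-- the automorphism of order dividing `p` -/
  σ : B ≃+* B
  /-- coordinate ring of the chart = degree-0 part -/
  e : Γ(V, O.1) ≃+* ↥(𝒜 0)
  tame : IsTameNode p B 𝒜 σ
  intertwine : ∀ t : Γ(V, O.1), ((e (actO ρ O g₀ t) : ↥(𝒜 0)) : B) = σ ((e t : ↥(𝒜 0)) : B)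

namespace NodeData

variable {p ρ g₀} {O : ρ.StableAffineOpens} (D : NodeData p ρ g₀ O)

/-- Node data make the open a node chart. -/
theorem isNodeChart (D : NodeData p ρ g₀ O) : IsNodeChart p ρ g₀ O :=
  ⟨D.affine, D.m, D.r, D.B, D.instCommRing, D.𝒜, D.instGradedRing, D.σ, D.e, D.tame, D.intertwine⟩

/-- **`PrincipalNear D u`**: some `G`-INVARIANT section `b ∈ Γ(V, O)` with `u ∈ D(b)` makes the augmentation ideal of the node ring principal after
inverting `e b` — «the node is KILLED near `u`». An open, `G`-stable condition. [OURS · L1 W4.5c · np-ATLAS (β)] -/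
def PrincipalNear (u : V) : Prop :=
  letI := D.instCommRing
  ∃ (b : Γ(V, O.1)), (∀ g : G, actO ρ O g b = b) ∧ u ∈ V.basicOpen b ∧
    ((augmentationIdeal D.σ).map (algebraMap D.B (Localization.Away ((D.e b : ↥(D.𝒜 0)) : D.B)))).IsPrincipal

/-- `PrincipalNear` only speaks about points of the chart. -/
theorem mem_of_principalNear {u : V} (h : D.PrincipalNear u) : u ∈ O.1 := by
  obtain ⟨b, -, hu, -⟩ := h
  exact V.basicOpen_le b hu

/-- **Openness**: the same witness works on the whole invariant basic open. -/
theorem principalNear_of_mem_basicOpen {u : V} (h : D.PrincipalNear u) :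
    ∃ b : Γ(V, O.1), u ∈ V.basicOpen b ∧ ∀ u' ∈ V.basicOpen b, D.PrincipalNear u' := by
  obtain ⟨b, hb, hu, hprin⟩ := h
  exact ⟨b, hu, fun u' hu' => ⟨b, hb, hu', hprin⟩⟩

/-- The set of points near which the node is principal is open. -/
theorem isOpen_setOf_principalNear : IsOpen {u : V | D.PrincipalNear u} := by
  rw [isOpen_iff_forall_mem_open]
  intro u hu
  obtain ⟨b, hub, hball⟩ := D.principalNear_of_mem_basicOpen hu
  exact ⟨V.basicOpen b, fun u' hu' => hball u' hu', (V.basicOpen b).isOpen, hub⟩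

/-- **`G`-stability**: `PrincipalNear D (g • u) ↔ PrincipalNear D u` (the witness is an invariant section). -/
theorem principalNear_aut_iff (g : G) (u : V) : D.PrincipalNear ((ρ.aut g).hom.base u) ↔ D.PrincipalNear u := by
  constructor
  · rintro ⟨b, hb, hu, hprin⟩
    refine ⟨b, hb, ?_, hprin⟩
    have : u ∈ (ρ.aut g).hom ⁻¹ᵁ V.basicOpen b := hu
    rwa [preimage_basicOpen_of_invariant ρ O hb g] at this
  · rintro ⟨b, hb, hu, hprin⟩
    refine ⟨b, hb, ?_, hprin⟩
    show u ∈ (ρ.aut g).hom ⁻¹ᵁ V.basicOpen b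
    rwa [preimage_basicOpen_of_invariant ρ O hb g]

end NodeData

/-! ## Node atlas DATA -/

/-- **Node atlas data**: a family of `G`-stable affine charts with node data covering `V`. [OURS · L1 W4.5c · np-ATLAS (α)] -/
structure NodeAtlasData : Type (u + 1) where
  /-- index type of the charts -/
  ι : Type u
  /-- the charts -/
  O : ι → ρ.StableAffineOpens
  /-- node data on each chart -/
  D : ∀ i, NodeData p ρ g₀ (O i)
  /-- the charts cover -/
  cover : ∀ v : V, ∃ i, v ∈ (O i).1

namespace NodeAtlasData

variable {p ρ g₀} (𝔄 : NodeAtlasData p ρ g₀)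

/-- Atlas data give a node atlas. -/
theorem nodeAtlas (𝔄 : NodeAtlasData p ρ g₀) : NodeAtlas p ρ g₀ := fun v => by
  obtain ⟨i, hi⟩ := 𝔄.cover v
  exact ⟨𝔄.O i, hi, (𝔄.D i).isNodeChart⟩

/-- **Compatibility** of the atlas: two charts through `u` agree on «principal near `u`». [OURS · L1 W4.5c · np-ATLAS (α)] -/
def Compatible : Prop :=
  ∀ (i j : 𝔄.ι) (u : V), u ∈ (𝔄.O i).1 → u ∈ (𝔄.O j).1 → ((𝔄.D i).PrincipalNear u ↔ (𝔄.D j).PrincipalNear u)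

/-- **The non-principal locus** of the atlas: points at which SOME chart of the atlas is not principal near the point. [OURS · L1 W4.5c · np-ATLAS (β)] -/
def npLocus : Set V :=
  {u | ∃ i, u ∈ (𝔄.O i).1 ∧ ¬ (𝔄.D i).PrincipalNear u}

/-- Membership, ∃-form (definitional). -/
theorem mem_npLocus_iff (u : V) : u ∈ 𝔄.npLocus ↔ ∃ i, u ∈ (𝔄.O i).1 ∧ ¬ (𝔄.D i).PrincipalNear u := Iff.rfl

variable {𝔄}

/-- Under compatibility: `u ∈ npLocus ↔` EVERY chart through `u` is non-principal near `u`. -/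
theorem mem_npLocus_iff_forall (hc : 𝔄.Compatible) (u : V) :
    u ∈ 𝔄.npLocus ↔ ∀ i, u ∈ (𝔄.O i).1 → ¬ (𝔄.D i).PrincipalNear u := by
  constructor
  · rintro ⟨i, hui, hni⟩ j huj hj
    exact hni ((hc i j u hui huj).mpr hj)
  · intro h
    obtain ⟨i, hui⟩ := 𝔄.cover u
    exact ⟨i, hui, h i hui⟩

/-- Under compatibility: `u ∉ npLocus ↔` SOME chart through `u` is principal near `u`. -/
theorem not_mem_npLocus_iff (hc : 𝔄.Compatible) (u : V) :
    u ∉ 𝔄.npLocus ↔ ∃ i, (𝔄.D i).PrincipalNear u := by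
  rw [mem_npLocus_iff_forall hc]
  push Not
  constructor
  · rintro ⟨i, -, hi⟩; exact ⟨i, hi⟩
  · rintro ⟨i, hi⟩; exact ⟨i, (𝔄.D i).mem_of_principalNear hi, hi⟩

/-- ★ **The non-principal locus is closed** (compatible atlas): its complement is the union of the open sets `{PrincipalNear (D i)}`. [OURS · L1 W4.5c] -/
theorem isClosed_npLocus (hc : 𝔄.Compatible) : IsClosed 𝔄.npLocus := by
  rw [← isOpen_compl_iff]
  have : 𝔄.npLocusᶜ = ⋃ i, {u : V | (𝔄.D i).PrincipalNear u} := by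
    ext u
    rw [Set.mem_compl_iff, not_mem_npLocus_iff hc, Set.mem_iUnion]
    rfl
  rw [this]
  exact isOpen_iUnion fun i => (𝔄.D i).isOpen_setOf_principalNear

/-- ★ **The non-principal locus is `G`-stable.** [OURS · L1 W4.5c] -/
theorem preimage_aut_npLocus (g : G) : (ρ.aut g).hom.base ⁻¹' 𝔄.npLocus = 𝔄.npLocus := by
  ext u
  simp only [Set.mem_preimage, mem_npLocus_iff]
  constructor
  · rintro ⟨i, hgu, hn⟩
    refine ⟨i, ?_, fun h => hn (((𝔄.D i).principalNear_aut_iff g u).mpr h)⟩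
    have : u ∈ (ρ.aut g).hom ⁻¹ᵁ (𝔄.O i).1 := hgu
    rwa [(𝔄.O i).2.1 g] at this
  · rintro ⟨i, hu, hn⟩
    refine ⟨i, ?_, fun h => hn (((𝔄.D i).principalNear_aut_iff g u).mp h)⟩
    show u ∈ (ρ.aut g).hom ⁻¹ᵁ (𝔄.O i).1
    rwa [(𝔄.O i).2.1 g]

/-- The non-principal locus, as a set, is invariant under each automorphism (image form). -/
theorem aut_base_mem_npLocus_iff (g : G) (u : V) : (ρ.aut g).hom.base u ∈ 𝔄.npLocus ↔ u ∈ 𝔄.npLocus := by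
  have := congrArg (u ∈ ·) (preimage_aut_npLocus (𝔄 := 𝔄) g)
  simpa only [Set.mem_preimage, eq_iff_iff] using this

/-! ### The carried FORMAL locus (∀-form; no compatibility needed) -/

/-- **The carried formal locus** `F_𝔄 := {u | no chart of the atlas is principal near u}` (plan-1 R-F14: the measure of the K-free frame lives here).
Closed, `G`-stable, `⊇ badLocus`, `= ∅ ⇒ Terminal` — WITHOUT any compatibility of the charts. [OURS · L1 W4.5c · R-F14] -/
def fLocus : Set V :=
  {u | ∀ i, u ∈ (𝔄.O i).1 → ¬ (𝔄.D i).PrincipalNear u}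

/-- Membership (definitional). -/
theorem mem_fLocus_iff (u : V) : u ∈ 𝔄.fLocus ↔ ∀ i, u ∈ (𝔄.O i).1 → ¬ (𝔄.D i).PrincipalNear u := Iff.rfl

/-- `u ∉ F_𝔄 ↔` SOME chart of the atlas is principal near `u`. -/
theorem not_mem_fLocus_iff (u : V) : u ∉ 𝔄.fLocus ↔ ∃ i, (𝔄.D i).PrincipalNear u := by
  rw [mem_fLocus_iff]
  push Not
  constructor
  · rintro ⟨i, -, hi⟩; exact ⟨i, hi⟩
  · rintro ⟨i, hi⟩; exact ⟨i, (𝔄.D i).mem_of_principalNear hi, hi⟩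

/-- The ∃-locus lies inside the ∀-locus... no: the ∀-locus lies inside the ∃-locus (`npLocus`). -/
theorem fLocus_subset_npLocus : 𝔄.fLocus ⊆ 𝔄.npLocus := by
  intro u hu
  obtain ⟨i, hui⟩ := 𝔄.cover u
  exact ⟨i, hui, hu i hui⟩

/-- ★ **The carried formal locus is closed.** [OURS · L1 W4.5c · R-F14] -/
theorem isClosed_fLocus : IsClosed 𝔄.fLocus := by
  rw [← isOpen_compl_iff]
  have : 𝔄.fLocusᶜ = ⋃ i, {u : V | (𝔄.D i).PrincipalNear u} := by
    ext u
    rw [Set.mem_compl_iff, not_mem_fLocus_iff, Set.mem_iUnion]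
    rfl
  rw [this]
  exact isOpen_iUnion fun i => (𝔄.D i).isOpen_setOf_principalNear

/-- ★ **The carried formal locus is `G`-stable.** [OURS · L1 W4.5c · R-F14] -/
theorem preimage_aut_fLocus (g : G) : (ρ.aut g).hom.base ⁻¹' 𝔄.fLocus = 𝔄.fLocus := by
  ext u
  simp only [Set.mem_preimage, mem_fLocus_iff]
  constructor
  · intro h i hu hn
    refine h i ?_ (((𝔄.D i).principalNear_aut_iff g u).mpr hn)
    show u ∈ (ρ.aut g).hom ⁻¹ᵁ (𝔄.O i).1
    rwa [(𝔄.O i).2.1 g]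
  · intro h i hgu hn
    have hu : u ∈ (𝔄.O i).1 := by
      have : u ∈ (ρ.aut g).hom ⁻¹ᵁ (𝔄.O i).1 := hgu
      rwa [(𝔄.O i).2.1 g] at this
    exact h i hu (((𝔄.D i).principalNear_aut_iff g u).mp hn)

end NodeAtlasData

/-! ## Atlas data from a node atlas (choice) -/

/-- **Node data from a node chart** (choice). -/
def NodeData.ofIsNodeChart {O : ρ.StableAffineOpens} (h : IsNodeChart p ρ g₀ O) : NodeData p ρ g₀ O := by
  classical
  choose m r B _ 𝒜 _ σ e htame hσ using h.2
  exact { affine := h.1, m := m, r := r, B := B, 𝒜 := 𝒜, σ := σ, e := e, tame := htame, intertwine := hσ }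

/-- **Atlas data from a node atlas** (choice): one node chart per point. [OURS · L1 W4.5c · R-F14 «initial plain atlas»] -/
def NodeAtlasData.ofNodeAtlas (h : NodeAtlas p ρ g₀) : NodeAtlasData p ρ g₀ := by
  classical
  choose O hO hnode using h
  exact { ι := V, O := O, D := fun v => NodeData.ofIsNodeChart (p := p) (ρ := ρ) (g₀ := g₀) (hnode v), cover := fun v => ⟨v, hO v⟩ }

/-! ## The bridge: principal near `u` ⇒ good at `u` -/

namespace GModelBridge

open NodeChartAway NodeAway GradedLocalization InvariantsRegular

variable {p : ℕ} {X' X₁ : Scheme.{0}} {q : X' ⟶ X₁} {G : Type} [Group G] {ρ : G →* Aut X'} {g₀ : G}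

/-- ★ **PRINCIPAL NEAR `u` ⇒ GOOD AT `u`.** On a model with Noetherian base, a point near which some node chart is principal (a KILLED node on an
invariant basic open) is GOOD: the invariant ring of the shrunk chart is a tame root chart (`isGoodAt_of_killedNode`). [OURS · L1 W4.5c · np-ATLAS (δ)] -/
theorem isGoodAt_of_principalNear [Finite G] (hG : ∀ g : G, g ∈ Subgroup.zpowers g₀) (hp : p.Prime)
    (M : GameFrame.GModel p q G ρ g₀) (hNB : M.HasNoetherianBase) {O : M.act.StableAffineOpens} (D : NodeData p M.act g₀ O)
    {u : M.V} (h : D.PrincipalNear u) : M.IsGoodAt u := by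
  letI := D.instCommRing
  letI := D.instGradedRing
  obtain ⟨b, hb, hub, hprin⟩ := h
  obtain ⟨R₀, _, _, s, _, hs⟩ := hNB
  -- node data on the invariant basic open `D(b)`
  obtain ⟨hσb, hnode', hσ', -⟩ := exists_nodeData_basicOpen M.act O D.affine hb D.𝒜 D.e g₀ D.σ D.tame D.intertwine
  letI := locGradedRing D.𝒜 (D.e b).2
  -- the shrunk node is KILLED
  have hI : (augmentationIdeal (sigmaAway D.σ hσb)).IsPrincipal := by
    rw [augmentationIdeal_sigmaAway]; exact hprin
  -- a Noetherian base ring of finite type under the shrunk node ring, σ-fixed, of degree 0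
  obtain ⟨φ₀, hφ₀, hφσ, hφ0⟩ := exists_baseRingHom_of_nodeChart M.act g₀ s hs O D.affine D.𝒜 D.σ D.e D.intertwine D.tame.2.2.2.1
  let φ : R₀ →+* Localization.Away ((D.e b : ↥(D.𝒜 0)) : D.B) := (algebraMap D.B _).comp φ₀
  letI : Algebra R₀ (Localization.Away ((D.e b : ↥(D.𝒜 0)) : D.B)) := φ.toAlgebra
  haveI : Algebra.FiniteType R₀ (Localization.Away ((D.e b : ↥(D.𝒜 0)) : D.B)) := by
    rw [← RingHom.finiteType_algebraMap]
    change φ.FiniteType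
    refine RingHom.FiniteType.comp ?_ hφ₀
    rw [RingHom.finiteType_algebraMap]
    haveI := IsLocalization.Away.finitePresentation ((D.e b : ↥(D.𝒜 0)) : D.B) (S := Localization.Away ((D.e b : ↥(D.𝒜 0)) : D.B))
    infer_instance
  refine M.isGoodAt_of_killedNode hG hp u (basicOpenStable M.act O D.affine hb) hub (isAffineOpen_basicOpenStable M.act O D.affine hb)
    D.r (Localization.Away ((D.e b : ↥(D.𝒜 0)) : D.B)) (locPiece D.𝒜 (D.e b).2) (sigmaAway D.σ hσb)
    (basicOpenNodeEquiv M.act O D.affine b D.𝒜 D.e) hnode' hσ' hI (R₀ := R₀) (fun a => ?_) (fun a => ?_)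
  · change sigmaAway D.σ hσb (algebraMap D.B _ (φ₀ a)) = algebraMap D.B _ (φ₀ a)
    rw [sigmaAway_algebraMap, hφσ]
  · change algebraMap D.B _ (φ₀ a) ∈ locPiece D.𝒜 (D.e b).2 0
    exact algebraMap_mem_locPiece D.𝒜 (D.e b).2 (hφ0 a)

/-- **`badLocus ⊆ npLocus`** for compatible atlas data on a model with Noetherian base. [OURS · L1 W4.5c · np-ATLAS] -/
theorem badLocus_subset_npLocus [Finite G] (hG : ∀ g : G, g ∈ Subgroup.zpowers g₀) (hp : p.Prime)
    (M : GameFrame.GModel p q G ρ g₀) (hNB : M.HasNoetherianBase) (𝔄 : NodeAtlasData p M.act g₀) (hc : 𝔄.Compatible) :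
    M.badLocus ⊆ 𝔄.npLocus := by
  intro u hu
  by_contra hn
  obtain ⟨i, hi⟩ := (NodeAtlasData.not_mem_npLocus_iff hc u).mp hn
  exact hu (isGoodAt_of_principalNear hG hp M hNB (𝔄.D i) hi)

/-- **`npLocus = ∅ ⇒ Terminal`** (compatible atlas data, Noetherian base). [OURS · L1 W4.5c · np-ATLAS (δ)] -/
theorem terminal_of_npLocus_eq_empty [Finite G] (hG : ∀ g : G, g ∈ Subgroup.zpowers g₀) (hp : p.Prime)
    (M : GameFrame.GModel p q G ρ g₀) (hNB : M.HasNoetherianBase) (𝔄 : NodeAtlasData p M.act g₀) (hc : 𝔄.Compatible)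
    (h : 𝔄.npLocus = ∅) : M.Terminal := by
  rw [GameFrame.GModel.terminal_iff_badLocus_eq_empty, ← Set.subset_empty_iff, ← h]
  exact badLocus_subset_npLocus hG hp M hNB 𝔄 hc

/-- **`badLocus ⊆ F_𝔄`** (carried formal locus; no compatibility). [OURS · L1 W4.5c · R-F14] -/
theorem badLocus_subset_fLocus [Finite G] (hG : ∀ g : G, g ∈ Subgroup.zpowers g₀) (hp : p.Prime)
    (M : GameFrame.GModel p q G ρ g₀) (hNB : M.HasNoetherianBase) (𝔄 : NodeAtlasData p M.act g₀) : M.badLocus ⊆ 𝔄.fLocus := by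
  intro u hu i hui hi
  exact hu (isGoodAt_of_principalNear hG hp M hNB (𝔄.D i) hi)

/-- **`F_𝔄 = ∅ ⇒ Terminal`**. [OURS · L1 W4.5c · R-F14] -/
theorem terminal_of_fLocus_eq_empty [Finite G] (hG : ∀ g : G, g ∈ Subgroup.zpowers g₀) (hp : p.Prime)
    (M : GameFrame.GModel p q G ρ g₀) (hNB : M.HasNoetherianBase) (𝔄 : NodeAtlasData p M.act g₀) (h : 𝔄.fLocus = ∅) : M.Terminal := by
  rw [GameFrame.GModel.terminal_iff_badLocus_eq_empty, ← Set.subset_empty_iff, ← h]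
  exact badLocus_subset_fLocus hG hp M hNB 𝔄

end GModelBridge

end Summit.ResolutionOfSingularities.ResolutionOfSingularities.Theorems.WildQuotientResolution.S1.NpFrame

end
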